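import Mathlib
import HarnessLib
import Summits.NavierStokesRegularity.NavierStokesRegularity.Theorems.PoloidalWindowDoorPoloidalWindowRigidityLrcJetKernel
import Summits.NavierStokesRegularity.NavierStokesRegularity.Theorems.PoloidalWindowDoorPoloidalWindowRigidityLrcJetKernel2
import Summits.NavierStokesRegularity.NavierStokesRegularity.Theorems.PoloidalWindowDoorPoloidalWindowRigidityLrcJetKernelU

/-!
# Line `lrc-jet` of crux K2 `PoloidalWindowRigidity` — kernel replay, part 4: bucketed row generator for the unsteady scheme

Cell ns-regularity-ideate, seat ns-poloidal-K2-cert-1, 2026-08-27. Bears on LADDER-NS N0 (route `PoloidalWindowDoor`, crux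
stmt-NavierStokesRegularity-19708, line lrc-jet v2, stub `stub_lrcSpatial`).  Same rows as `rowGenU2` of `…LrcJetKernelU`, but the
base jet is bucketed by component AND by the first spatial exponent `a₀` (each bucket in ascending weighted degree), so that the
transport part of a row with monomial `m` only visits buckets `a₀' ≤ m₀` and the stretching part only buckets `a₀' ≤ m₀ + 1`: ≈ 3×
fewer kernel steps per row (the unsteady order-13 certificates have 1 164–1 359 weighted rows each).  Checker `certCheckU3` and
soundness `dot_eq_zero_of_certCheckU3(_mkY)` as before.  Cross-checked against the seat engine's rows by `decide +kernel`.

WHAT THIS IS NOT: not a statement about Navier–Stokes regularity; list/linear-algebra bookkeeping for the certificates.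
-/

set_option linter.dupNamespace false
set_option autoImplicit false

namespace Summit.NavierStokesRegularity.NavierStokesRegularity.Theorems.PoloidalWindowDoorPoloidalWindowRigidityLrcJetKernelU2

open Summit.NavierStokesRegularity.NavierStokesRegularity.Theorems.PoloidalWindowDoorPoloidalWindowRigidityLrcJetKernel
open Summit.NavierStokesRegularity.NavierStokesRegularity.Theorems.PoloidalWindowDoorPoloidalWindowRigidityLrcJetKernel2
open Summit.NavierStokesRegularity.NavierStokesRegularity.Theorems.PoloidalWindowDoorPoloidalWindowRigidityLrcJetKernelU

/-- base jet bucketed `[component][a₀]`, each bucket a term list in ascending weighted degree. -/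
abbrev JetTermsUB : Type := List (List (List (ℕ × Mono4 × ℚ)))

/-- **Bucketed row generator of the unsteady scheme** (same rows as `rowGenU2`). -/
def rowGenU3 (VB : JetTermsUB) (r : RowD) : SpVec :=
  let n := r.1; let kind := r.2.1; let i := r.2.2.1; let pos := r.2.2.2
  if kind = 0 then
    let m := monoAtU (n - 2) pos
    let dt := [(colVU i n (madd4 m 3 1), (((mget4 m 3 + 1 : ℕ) : ℤ) : ℚ))]
    let lap := (List.range 3).map fun k =>
      (colVU i n (madd4 m k 2), -((((mget4 m k + 2) * (mget4 m k + 1) : ℕ) : ℤ) : ℚ))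
    let pres := [(colPU (n - 1) (madd4 m i 1), (((mget4 m i + 1 : ℕ) : ℤ) : ℚ))]
    let bilA := VB.flatMap fun Vj => (Vj.take (m.1 + 1)).flatMap fun bucket =>
      (bucket.takeWhile fun t => decide (wdeg t.2.1 + 3 ≤ n)).filterMap fun t =>
        let j := t.1; let m' := t.2.1; let c := t.2.2
        if mle4 m' m then
          some (colVU i (n - 1 - wdeg m') (madd4 (msub4 m m') j 1), c * (((mget4 m j - mget4 m' j + 1 : ℕ) : ℤ) : ℚ))
        else none
    let bilB := ((VB.getD i []).take (m.1 + 2)).flatMap fun bucket =>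
      (bucket.takeWhile fun t => decide (wdeg t.2.1 + 1 ≤ n)).flatMap fun t =>
        (List.range 3).filterMap fun j =>
          let μ := t.2.1; let c := t.2.2
          if decide (1 ≤ mget4 μ j) then
            let μ' := msub4 μ (madd4 (0, 0, 0, 0) j 1)
            if mle4 μ' m then
              let m' := msub4 (madd4 m j 1) μ
              if decide (2 ≤ wdeg m') then some (colVU j (wdeg m') m', (((mget4 μ j : ℕ) : ℤ) : ℚ) * c) else none
            else none
          else none
    dt ++ lap ++ pres ++ bilA ++ bilB
  else if kind = 1 then
    let m := monoAtU (n - 1) pos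
    (List.range 3).map fun k => (colVU k n (madd4 m k 1), (((mget4 m k + 1 : ℕ) : ℤ) : ℚ))
  else
    let m := monoAtU (n - 1) pos
    [(colVU 1 n (madd4 m 0 1), (((mget4 m 0 + 1 : ℕ) : ℤ) : ℚ)), (colVU 0 n (madd4 m 1 1), -(((mget4 m 1 + 1 : ℕ) : ℤ) : ℚ))]

/-- sorted, scaled rows. -/
def scaledRowsU3 (VB : JetTermsUB) (Y : List (RowD × ℚ)) : List SpVec :=
  Y.map fun e => isortAdd (scale e.2 (rowGenU3 VB e.1))

/-- total `dot` of the scaled rows. -/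
theorem sumDot_scaledRowsU3 (VB : JetTermsUB) (δ : ℕ → ℚ) :
    ∀ Y : List (RowD × ℚ), sumDot (scaledRowsU3 VB Y) δ = (Y.map fun e => e.2 * dot (rowGenU3 VB e.1) δ).sum
  | [] => rfl
  | e :: Y => by
    have ih := sumDot_scaledRowsU3 VB δ Y
    simp only [scaledRowsU3, sumDot, List.map_cons, List.sum_cons] at *
    rw [dot_isortAdd, dot_scale, ih]

/-- **certificate check (bucketed, unsteady)**. -/
def certCheckU3 (F : ℕ) (VB : JetTermsUB) (Y : List (RowD × ℚ)) (D : ℚ) (c : SpVec) : Bool :=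
  dropZeros (mergeAll 64 F (scaledRowsU3 VB Y)) == dropZeros (isortAdd (scale D c))

/-- **Soundness.** -/
theorem dot_eq_zero_of_certCheckU3 (F : ℕ) (VB : JetTermsUB) (Y : List (RowD × ℚ)) (D : ℚ) (c : SpVec)
    (hD : D ≠ 0) (hcheck : certCheckU3 F VB Y D c = true) (δ : ℕ → ℚ)
    (hJ : ∀ e ∈ Y, dot (rowGenU3 VB e.1) δ = 0) : dot c δ = 0 := by
  have h : dropZeros (mergeAll 64 F (scaledRowsU3 VB Y)) = dropZeros (isortAdd (scale D c)) := by
    simpa [certCheckU3] using hcheck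
  have h1 : dot (mergeAll 64 F (scaledRowsU3 VB Y)) δ = D * dot c δ := by
    rw [← dot_dropZeros, h, dot_dropZeros, dot_isortAdd, dot_scale]
  have h2 : dot (mergeAll 64 F (scaledRowsU3 VB Y)) δ = 0 := by
    rw [dot_mergeAll, sumDot_scaledRowsU3]
    apply List.sum_eq_zero
    intro x hx
    rw [List.mem_map] at hx
    obtain ⟨e, he, rfl⟩ := hx
    rw [hJ e he, mul_zero]
  have : D * dot c δ = 0 := by rw [← h1, h2]
  rcases mul_eq_zero.mp this with h | h
  · exact absurd h hD
  · exact h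

/-- soundness with rows given by indices. -/
theorem dot_eq_zero_of_certCheckU3_mkY (F N : ℕ) (VB : JetTermsUB) (rows : List ℕ) (w : List ℤ) (D : ℚ) (c : SpVec)
    (B : ℕ) (hB : rows.all (fun r => decide (r < B)) = true) (hD : D ≠ 0)
    (hcheck : certCheckU3 F VB (mkYU N rows w) D c = true) (δ : ℕ → ℚ)
    (hJ : ∀ r, r < B → dot (rowGenU3 VB (rowOfIndexU N r)) δ = 0) : dot c δ = 0 := by
  refine dot_eq_zero_of_certCheckU3 F VB (mkYU N rows w) D c hD hcheck δ ?_
  intro e he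
  unfold mkYU at he
  rw [List.mem_map] at he
  obtain ⟨p, hp, rfl⟩ := he
  have hmem : p.1 ∈ rows := (List.of_mem_zip hp).1
  have hlt : p.1 < B := of_decide_eq_true (List.all_eq_true.mp hB _ hmem)
  exact hJ _ hlt

/-- bucketed base jet from parallel lists (component-major, then ascending `a₀`-independent order is fine: buckets are built
by filtering; inside a bucket the order of the input list is kept, so list the terms in ascending weighted degree). -/
def mkVUB (amax : ℕ) (js : List ℕ) (ex : List Mono4) (num : List ℤ) (den : List ℤ) : JetTermsUB :=
  let all := (List.zip js (List.zip ex (List.zip num den))).map fun e => (e.1, e.2.1, Rat.divInt e.2.2.1 e.2.2.2)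
  (List.range 3).map fun i => (List.range (amax + 1)).map fun a => all.filter fun t => decide (t.1 = i) && decide (t.2.1.1 = a)

end Summit.NavierStokesRegularity.NavierStokesRegularity.Theorems.PoloidalWindowDoorPoloidalWindowRigidityLrcJetKernelU2
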